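import Mathlib
import Summits.PneNP.PneNP.Theses.LatticeMagic
import Literature.Computability.MetaComplexity.XorPseudoexpectation
import Literature.Computability.MetaComplexity.ScopeExpansion

/-!
# Sketch — crux-ideate stmt-PneNP-2330 (BooleanSosBlindAtConstantFactor), ideator 1, round 1

First-lemma signatures for the two idea cards
* `construction-a-xor-embedding`  (Construction-A embedding of expanding XOR systems; all SOS
  ingredients are PROVED tree theorems: `XorDerivation`, `XorPseudoexpectation`, `ScopeExpansion`),
* `half-integer-knapsack-coordinate` (Grigoriev–Laurent knapsack pseudoexpectation in one
  coordinate; needs the classical knapsack degree bound as a fact).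
Nothing here is proved; the point is that the statements elaborate over existing declarations and
that `Fooled`/`closenessPoly` are LITERALLY the crux's inner clause (`crux_iff` is `Iff.rfl`).
-/

noncomputable section

open MvPolynomial Filter
open Literature.Algebra.EuclideanLattices Literature.Computability.MetaComplexity

namespace Summit.PneNP.PneNP.Cruxes.BooleanSosBlindAtConstantFactor.Sketch

/-- The closeness polynomial of the crux for an instance `p = ((B,t),d)` and bit budget `m`
(copied verbatim from the route decl). -/
def closenessPoly (p : GapCVPInstance) (m : ℕ) : MvPolynomial ℕ ℝ :=
  (∑ k : Fin p.1.I.n, (∑ i : Fin p.1.I.n, ((∑ b ∈ Finset.range m, ((2 : ℝ) ^ b) •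
    MvPolynomial.X (Nat.pair i.val (b + 1))) - MvPolynomial.C ((2 ^ (m - 1) : ℕ) : ℝ)) *
    MvPolynomial.C ((p.1.I.basis i k : ℤ) : ℝ) - MvPolynomial.C ((p.1.target k : ℤ) : ℝ)) ^ 2) +
    (∑ b ∈ Finset.range m, ((2 : ℝ) ^ b) • MvPolynomial.X (Nat.pair b 0)) -
    MvPolynomial.C ((⌊(p.2 : ℝ) ^ 2⌋ : ℤ) : ℝ)

/-- "Degree-`D` Boolean SOS does not refute the closeness system of `(p, m)`" (KMOW primal form,
tree vocabulary). -/
def Fooled (D : ℕ) (p : GapCVPInstance) (m : ℕ) : Prop :=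
  ∃ E : MvPolynomial ℕ ℝ →ₗ[ℝ] ℝ, IsPseudoexpectation D E ∧
    (∀ v : ℕ, SatisfiesIdentity D E (boolAxiom v)) ∧ SatisfiesIdentity D E (closenessPoly p m)

/-- Sanity: the crux is literally `∃ γ₀ δ C, ∀ n₀, ∃ p m, … ∧ Fooled ⌈n^δ⌉₊ p m`. -/
theorem crux_iff : Summit.PneNP.PneNP.Theses.LatticeMagic.BooleanSosBlindAtConstantFactor ↔
    ∃ γ₀ : ℝ, 1 ≤ γ₀ ∧ ∃ δ : ℝ, 0 < δ ∧ ∃ C : ℕ, ∀ n₀ : ℕ, ∃ (p : GapCVPInstance) (m : ℕ),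
      n₀ ≤ p.1.I.n ∧ p ∈ GapCVP.no (fun _ => γ₀) ∧ (GapCVPInstance.encode p).length ≤ p.1.I.n ^ C ∧
      m ≤ p.1.I.n ^ C ∧ Fooled ⌈(p.1.I.n : ℝ) ^ δ⌉₊ p m :=
  Iff.rfl

/-! ## Card `construction-a-xor-embedding` -/

/-- Construction-A basis of an XOR system with scopes `S e ⊆ Fin N` (`e : Fin me`), dimension
`N + me`: rows `b_i = 2 e_i + Σ_{e ∋ i} e_{N+e}` for `i < N` and `b_{N+e} = 2 e_{N+e}`
(block upper-triangular, determinant `2^(N+me)`). -/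
def conABasis (N me : ℕ) (S : Fin me → Finset (Fin N)) : Matrix (Fin (N + me)) (Fin (N + me)) ℤ :=
  fun i k =>
    match finSumFinEquiv.symm i, finSumFinEquiv.symm k with
    | Sum.inl i', Sum.inl k' => if i' = k' then 2 else 0
    | Sum.inl i', Sum.inr e => if i' ∈ S e then 1 else 0
    | Sum.inr _, Sum.inl _ => 0
    | Sum.inr e, Sum.inr e' => if e = e' then 2 else 0

/-- Target `t = (1, …, 1, β)`: a deep hole of `2ℤ^N` in the message block, the XOR right-hand
sides in the check block. -/
def conATarget (N me : ℕ) (β : Fin me → Bool) : Fin (N + me) → ℤ :=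
  fun k => match finSumFinEquiv.symm k with
    | Sum.inl _ => 1
    | Sum.inr e => if β e then 1 else 0

/-- The GapCVP instance `((B, t), d)` of the Construction-A embedding. -/
def conAInstance (N me : ℕ) (S : Fin me → Finset (Fin N)) (β : Fin me → Bool) (d : ℚ) :
    GapCVPInstance :=
  (⟨⟨N + me, conABasis N me S⟩, conATarget N me β⟩, d)

/-- FIRST LEMMA (card B, the load-bearing transfer): if the scopes are `(r, c)`-boundary
expanding with `|S e| ≤ 3`, the Grigoriev–Schoenebeck pseudo-moments of the parity system
(tree: `pseudoMoment`, PSD by `pseudoMoment_quadratic_nonneg`, parity identities by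
`pseudoMoment_index_add`) pushed forward along the substitution
`x_(i,1) ↦ ξ_i, x_(i,2) ↦ 1, x_(N+e,1) ↦ h_e = (Σ_{S e} ξ − β_e)/2, x_(N+e,2) ↦ 1 − h_e, rest ↦ 0`
give a degree-`d/3` pseudoexpectation for the closeness system with `m = 2` bits whenever
`⌊d₀²⌋ = N` (the closeness identity holds EXACTLY under the substitution; Booleanity of the
escape bits reduces to the parity identities). -/
theorem conA_fooled {N me : ℕ} (S : Fin me → Finset (Fin N)) (β : Fin me → Bool)
    (hS : ∀ e, (S e).card ≤ 3) {r c : ℝ} {d : ℕ}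
    (hexp : IsBoundaryExpander (fun e => (S e).map Fin.valEmbedding) r c)
    (hc : 0 < c) (hr : 2 ≤ r) (hd : (d : ℝ) ≤ c * r / 2)
    (d₀ : ℚ) (hd₀ : ⌊(d₀ : ℝ) ^ 2⌋ = N) :
    Fooled (d / 3) (conAInstance N me S β d₀) 2 := by
  sorry

/-- Second lemma (card B, geometry): an UNSATISFIABLE parity system gives a NO-instance of
`GapCVP_1` with `d₀² < N + 1`: every lattice vector `v = (2z, Az + 2u)` has
`‖v − t‖² = Σ_i (2 z_i − 1)² + Σ_e (Σ_{i ∈ S e} z_i + 2 u_e − β_e)² ≥ N + 1`. -/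
theorem conA_no {N me : ℕ} (S : Fin me → Finset (Fin N)) (β : Fin me → Bool)
    (hunsat : ∀ x : Fin N → ZMod 2, ∃ e, (∑ i ∈ S e, x i) ≠ (if β e then 1 else 0))
    (d₀ : ℚ) (h0 : 0 < d₀) (hd₀ : (d₀ : ℝ) ^ 2 < N + 1) :
    conAInstance N me S β d₀ ∈ GapCVP.no (fun _ => (1 : ℝ)) := by
  sorry

/-- Third lemma (card B, supply of instances): expanding AND unsatisfiable 3-XOR systems with
linearly many equations exist for all large `N` (scopes: a sample point of the event of the PROVED
tree theorem `kmow_random_kCNF_plausible_holds` at `k = 3, Δ = 10, ζ = 1/2`; right-hand side: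
any `β` outside the image of `x ↦ (⊕_{i ∈ S e} x_i)_e`, which exists because `me = 10 N > N`;
alternative deterministic source: Tseitin on `Literature.Computability.Complexity.Expander.Family.X`). -/
theorem exists_expanding_unsat_xor : ∃ a : ℝ, 0 < a ∧ ∀ᶠ N : ℕ in atTop,
    ∃ (me : ℕ) (S : Fin me → Finset (Fin N)) (β : Fin me → Bool),
      me ≤ 10 * N ∧ (∀ e, (S e).card ≤ 3) ∧
      IsBoundaryExpander (fun e => (S e).map Fin.valEmbedding) (a * N) (1 / 2) ∧
      ∀ x : Fin N → ZMod 2, ∃ e, (∑ i ∈ S e, x i) ≠ (if β e then 1 else 0) := by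
  sorry

/-- Assembly shape for card B (how the three lemmas give the crux with `γ₀ = 1`, any `δ < 1`). -/
theorem crux_of_cardB
    (h₁ : ∀ {N me : ℕ} (S : Fin me → Finset (Fin N)) (β : Fin me → Bool),
      (∀ e, (S e).card ≤ 3) → ∀ {r c : ℝ} {d : ℕ},
      IsBoundaryExpander (fun e => (S e).map Fin.valEmbedding) r c → 0 < c → 2 ≤ r →
      (d : ℝ) ≤ c * r / 2 → ∀ d₀ : ℚ, ⌊(d₀ : ℝ) ^ 2⌋ = N → Fooled (d / 3) (conAInstance N me S β d₀) 2)
    (h₂ : ∀ {N me : ℕ} (S : Fin me → Finset (Fin N)) (β : Fin me → Bool),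
      (∀ x : Fin N → ZMod 2, ∃ e, (∑ i ∈ S e, x i) ≠ (if β e then 1 else 0)) →
      ∀ d₀ : ℚ, 0 < d₀ → (d₀ : ℝ) ^ 2 < N + 1 → conAInstance N me S β d₀ ∈ GapCVP.no (fun _ => (1 : ℝ)))
    (h₃ : ∃ a : ℝ, 0 < a ∧ ∀ᶠ N : ℕ in atTop,
      ∃ (me : ℕ) (S : Fin me → Finset (Fin N)) (β : Fin me → Bool),
        me ≤ 10 * N ∧ (∀ e, (S e).card ≤ 3) ∧
        IsBoundaryExpander (fun e => (S e).map Fin.valEmbedding) (a * N) (1 / 2) ∧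
        ∀ x : Fin N → ZMod 2, ∃ e, (∑ i ∈ S e, x i) ≠ (if β e then 1 else 0)) :
    Summit.PneNP.PneNP.Theses.LatticeMagic.BooleanSosBlindAtConstantFactor := by
  sorry

/-- Cheapest falsifier (b) of card B, in Lean: the message coordinates contribute the constant 1
each on the pseudo-side, `(2 ξ_i − 1)² = 1` in `ParityAlg`. -/
example (v : ℕ) : (2 * phiX v - 1) * (2 * phiX v - 1) = (1 : ParityAlg) := by
  have h := phiX_mul_self v
  linear_combination (4 : ParityAlg) * h

/-! ## Card `half-integer-knapsack-coordinate` -/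

/-- Grigoriev's knapsack theorem in the tree's vocabulary (to be vendored as a named Literature
fact with its printed degree, or proved after Kurpisz–Leppänen–Mastrolilli / Potechin): for odd
`N` the symmetric functional `Ẽ[y_S] = Π_{j<|S|} (N/2 − j)/(N − j)` is a pseudoexpectation of
degree `⌊a N⌋` for `{Σ y_i = N/2, y_i² = y_i}`. Stated existentially with an unspecified linear
constant `a` (the printed bound is degree ≈ N/2… to be pinned by the grounder). -/
def GrigorievKnapsackSOS : Prop :=
  ∃ a : ℝ, 0 < a ∧ ∀ N : ℕ, Odd N → ∃ L : MvPolynomial (Fin N) ℝ →ₗ[ℝ] ℝ, L 1 = 1 ∧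
    (∀ p : MvPolynomial (Fin N) ℝ, 2 * (p.totalDegree : ℝ) ≤ a * N → 0 ≤ L (p * p)) ∧
    (∀ (i : Fin N) (r : MvPolynomial (Fin N) ℝ), L ((X i ^ 2 - X i) * r) = 0) ∧
    (∀ r : MvPolynomial (Fin N) ℝ, (r.totalDegree : ℝ) + 1 ≤ a * N →
      L ((∑ i : Fin N, X i - C ((N : ℝ) / 2)) * r) = 0)

/-- The one-hidden-coordinate knapsack lattice: dimension `N + 1`, rows `b_i = 2 e_i + 2M e_N`
(`i < N`), `b_N = 4M e_N`. -/
def knapBasis (N : ℕ) (M : ℤ) : Matrix (Fin (N + 1)) (Fin (N + 1)) ℤ :=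
  fun i k =>
    if k = Fin.last N then (if i = Fin.last N then 4 * M else 2 * M)
    else (if i = k then 2 else 0)

/-- Target `t = (−1, …, −1, −M N)` (so that the last coordinate of `zB − t` is
`M (2 Σ_{i<N} z_i + 4 z_N + N)`, odd multiple of `M` for every integer `z` when `N` is odd). -/
def knapTarget (N : ℕ) (M : ℤ) : Fin (N + 1) → ℤ :=
  fun k => if k = Fin.last N then -(M * N) else -1

/-- The instance `((B, t), d₀)`. -/
def knapInstance (N : ℕ) (M : ℤ) (d₀ : ℚ) : GapCVPInstance :=
  (⟨⟨N + 1, knapBasis N M⟩, knapTarget N M⟩, d₀)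

/-- FIRST LEMMA (card A, the transfer): Grigoriev's functional pushed forward along
`x_(i,1) ↦ 1 − y_i (i < N), x_(N,1) ↦ 1, rest ↦ 0` (bit budget `m = 1`, so `z_i = x_(i,1) − 1`)
fools the closeness system in degree `⌊a N⌋` when `⌊d₀²⌋ = N`:
under the substitution `Q ≡ 4 Σ_i (y_i² − y_i) + 4 M² (Σ_i y_i − N/2)²`. -/
theorem knap_fooled (h : GrigorievKnapsackSOS) : ∃ a : ℝ, 0 < a ∧ ∀ N : ℕ, Odd N →
    ∀ (M : ℤ) (d₀ : ℚ), ⌊(d₀ : ℝ) ^ 2⌋ = N → Fooled ⌊a * N⌋₊ (knapInstance N M d₀) 1 := by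
  sorry

/-- Second lemma (card A, geometry): for odd `N`, `M ≥ 1` and `γ² · d₀² < N + M²` the instance is
a NO-instance of `GapCVP_γ` (`‖zB − t‖² = Σ_{i<N}(2z_i+1)² + M²(2Σz_i + 4z_N + N)² ≥ N + M²`). In
particular `γ = 1, M = 1, d₀² = N`; and `M = ⌈γ⌉ √N` reaches every factor `γ` — the typed rung is
insensitive to the approximation factor. -/
theorem knap_no {N : ℕ} (hN : Odd N) {M : ℤ} (hM : 1 ≤ M) (γ : ℝ) (hγ : 1 ≤ γ) (d₀ : ℚ)
    (h0 : 0 < d₀) (hfar : γ ^ 2 * (d₀ : ℝ) ^ 2 < N + (M : ℝ) ^ 2) :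
    knapInstance N M d₀ ∈ GapCVP.no (fun _ => γ) := by
  sorry

end Summit.PneNP.PneNP.Cruxes.BooleanSosBlindAtConstantFactor.Sketch
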